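import Literature.MathematicalPhysics.QuantumFieldTheory.Balaban1983to89.AveragingRT
import Literature.MathematicalPhysics.QuantumFieldTheory.Balaban1983to89.T4TrajectoryDensity

/-!
# SUBSTRATE — FIBRED AVERAGINGS and the DRESSED STEP: the one-step renormalization transform as a fibre integral
# (everywhere, not a.e.), its identity with the transport of record, and the `wOp` shape of NE1′ F-2

Cell `pub-balaban`, SUBSTRATE cell (coordinator + user 2026-08-20), seat `b2b-balaban-substrate-p2`; registry item S-F2 of
`substrate/STATUS.md` §2 ∕ typer sketch `substrate/typer/SubstrateSketch.v0.2.lean` §F2 ([dict] line D-5 for row NE1′ leaf F-2).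
Summits-side, under the LEAN PLACEMENT RULE (cell modelling + bookkeeping; NOT a Literature module); imports `AveragingRT` (the
transport of record `rnTransport`, the axial average) and `T4TrajectoryDensity` (`wOp`) BY NAME, edits nothing.

HONEST FRAMING (T4-DAG p. 1).  Rung (B)+1 of the FINITE-VOLUME T⁴ continuum programme — NOT infinite volume, NOT a mass gap, NOT the
Clay problem, NOT summit progress, no estimate of any NE row.  What is proved is measure-theoretic bookkeeping (Fubini, change of
variables, Radon–Nikodym uniqueness) about ANY averaging map that admits a fibred structure; that Bałaban's block averaging
`blockAvg ℰ` admits one ([Balaban1987RG1] §1: the parametrisation of the fine field by the coarse field and the fluctuation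
variables) is NOT asserted here (typer's `FibredBlockAvg_stmt`, untyped); the axial average's fibred structure
(`FibredAxial_stmt`) is a follower.  HONEST DEPENDENCY (cell line, verbatim): continuum YM on T⁴ ⇐ BetaPertH ∧ nine spine estimates
(0/9 proved); BetaPertH ⇐ (D1) ∧ (D4) ∧ CAP+tail; G-an2-4 gates asym, D1 and NE2/3/4.

WHAT THIS FILE DOES (sketch names in brackets).
* §1 DATA (verbatim from the sketch): `FibredAveraging P j G avg` — a measurable, Haar-compatible parametrisation
  `Φ : Z × 𝒰_{j+1} → 𝒰_j` of the fibres of `avg` (`avg (Φ (z, V)) = V`, `Φ_*(μ_Z ⊗ dV) = dU`); `fibreTransport A ρ V := ∫ ρ(Φ(z,V)) dμ_Z`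
  (defined at EVERY `V`); `fibreWeight A ρ V z := (ρ(Φ(z,V)) : ℂ)`.  Derived: the fluctuation measure is automatically a PROBABILITY
  measure (`isProbabilityMeasure_μZ`: total masses of `Φ_*(μ_Z ⊗ dV)` and `dU` agree), and the averaging is Haar-compatible
  (`map_avg_fieldMeasure : avg_* dU = dV`, for measurable `avg`).
* §2 **`isRT_fibreTransport`** [`FibreIsRT_stmt`, with `Measurable avg` ADDED — the right side of `Setup.IsRT` integrates `f ∘ avg`
  against `dU`, which is meaningless for a non-measurable `avg`]: for an integrable density the fibre transport IS a renormalization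
  transform, `IsRT avg ρ (fibreTransport A ρ)` (Fubini on `μ_Z ⊗ dV` + `map_Φ`); `integrable_fibreTransport`.
* §3 **`fibreTransport_ae_eq_rnTransport`** [`FibreTransportAE_stmt`]: `fibreTransport A ρ =ᵐ[dV] AveragingRT.rnTransport avg ρ` — two
  integrable solutions of the push-forward identity agree a.e. (`isRT_unique`, by indicator test functions and
  `Integrable.ae_eq_of_forall_setIntegral_eq`).
* §4 **`fibreTransport_dressed`** [`DressedStep_stmt`]: wherever the fibre integrals exist and `(Tρ)(V) ≠ 0`,
  `∫ ρ(Φ(z,V))·f(Φ(z,V)) dμ_Z = (Tρ)(V) · wOp (fibreWeight A ρ) μ_Z z₀ V (f ∘ Φ(·,V))` — LITERALLY the `T4TrajectoryDensity.wOp` shape of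
  NE1′ F-2's `hFn`, read on a transport that agrees a.e. with the transport of record (§3).
No estimate, no `def … : Prop`, no `sorry`.

References (KIND only): [Balaban1985Averaging] (10)–(11) p. 19 (the renormalization transformation as an integral over the fibre);
[Balaban1987RG1] (0.13) p. 254; [Balaban1989LargeFieldII] (1.75) p. 380 (the normalised operation `wOp` models).
-/

noncomputable section

open scoped BigOperators
open _root_.MeasureTheory

namespace Summit.QuantumFields.BalabanUV.T4Continuum.SubstrateFibredAveraging

open Literature.MathematicalPhysics.QuantumFieldTheory.Balaban1983to89
open Literature.MathematicalPhysics.QuantumFieldTheory.Balaban1983to89.AveragingRT (rnTransport isRT_rnTransport rnDensity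
  integral_rnDensity_mul)
open Literature.MathematicalPhysics.QuantumFieldTheory.Balaban1983to89.T4TrajectoryDensity (wOp wOp_of_pos)

/-! ## §1 Fibred averagings (data) -/

/-- [folklore] A FIBRED structure for an averaging map: a measurable, Haar-compatible parametrisation of the fine field by
(fluctuation variable, coarse field) — typer sketch v0.2 §F2 verbatim. -/
structure FibredAveraging (P : Params) (j : ℕ) (G : Type*) [GaugeGroup G] [MeasurableSpace G] [HaarData G]
    (avg : GaugeField P j G → GaugeField P (j + 1) G) where
  /-- fluctuation variable space -/
  Z : Type
  [mZ : MeasurableSpace Z]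
  /-- fluctuation measure -/
  μZ : Measure Z
  /-- the parametrisation of the fibre over `V` -/
  Φ : Z × GaugeField P (j + 1) G → GaugeField P j G
  measurable_Φ : Measurable Φ
  /-- it parametrises the fibre: `avg ∘ Φ = snd` -/
  avg_Φ : ∀ z V, avg (Φ (z, V)) = V
  /-- Haar compatibility: `Φ_*(μ_Z ⊗ dV) = dU` -/
  map_Φ : (μZ.prod (fieldMeasure P (j + 1) G)).map Φ = fieldMeasure P j G

attribute [instance] FibredAveraging.mZ

variable {P : Params} {j : ℕ} {G : Type*} [GaugeGroup G] [MeasurableSpace G] [HaarData G]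
variable {avg : GaugeField P j G → GaugeField P (j + 1) G}

/-- [folklore] THE FIBRE TRANSPORT of a density: `(Tρ)(V) := ∫ ρ(Φ(z, V)) dμ_Z(z)` — defined at EVERY `V` (sketch verbatim). -/
def fibreTransport (A : FibredAveraging P j G avg) (ρ : Density P j G) : Density P (j + 1) G :=
  fun V => ∫ z, ρ (A.Φ (z, V)) ∂A.μZ

/-- [folklore] The fibre weight seen by `wOp`: `ω V z := ρ(Φ(z, V))` as a complex number (sketch verbatim). -/
def fibreWeight (A : FibredAveraging P j G avg) (ρ : Density P j G) : GaugeField P (j + 1) G → A.Z → ℂ :=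
  fun V z => ((ρ (A.Φ (z, V)) : ℝ) : ℂ)

/-- [folklore] `fibreTransport` unfolded. -/
theorem fibreTransport_apply (A : FibredAveraging P j G avg) (ρ : Density P j G) (V : GaugeField P (j + 1) G) :
    fibreTransport A ρ V = ∫ z, ρ (A.Φ (z, V)) ∂A.μZ := rfl

/-- [folklore] `fibreWeight` unfolded. -/
theorem fibreWeight_apply (A : FibredAveraging P j G avg) (ρ : Density P j G) (V : GaugeField P (j + 1) G) (z : A.Z) :
    fibreWeight A ρ V z = ((ρ (A.Φ (z, V)) : ℝ) : ℂ) := rfl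

/-- [folklore] THE FLUCTUATION MEASURE IS A PROBABILITY MEASURE: `Φ_*(μ_Z ⊗ dV) = dU` forces `μ_Z(Z)·dV(𝒰) = dU(𝒰) = 1`. -/
theorem μZ_univ (A : FibredAveraging P j G avg) : A.μZ Set.univ = 1 := by
  have h := congrArg (fun μ : Measure (GaugeField P j G) => μ Set.univ) A.map_Φ
  simp only [Measure.map_apply A.measurable_Φ MeasurableSet.univ, Set.preimage_univ] at h
  rw [← Set.univ_prod_univ, Measure.prod_prod] at h
  simpa using h

/-- [folklore] … as an instance-providing theorem. -/
theorem isProbabilityMeasure_μZ (A : FibredAveraging P j G avg) : IsProbabilityMeasure A.μZ := ⟨μZ_univ A⟩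

/-- [folklore] The fluctuation measure is s-finite (it is finite). -/
instance instSFiniteμZ (A : FibredAveraging P j G avg) : SFinite A.μZ := by
  haveI := isProbabilityMeasure_μZ A
  infer_instance

/-- [folklore] **A FIBRED AVERAGING IS HAAR-COMPATIBLE**: `avg_* dU = dV` (for measurable `avg`): `avg ∘ Φ = snd` and `μ_Z` is a
probability measure. -/
theorem map_avg_fieldMeasure (A : FibredAveraging P j G avg) (havg : Measurable avg) :
    (fieldMeasure P j G).map avg = fieldMeasure P (j + 1) G := by
  haveI := isProbabilityMeasure_μZ A
  have hcomp : avg ∘ A.Φ = Prod.snd := funext fun p => by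
    obtain ⟨z, V⟩ := p
    exact A.avg_Φ z V
  rw [← A.map_Φ, Measure.map_map havg A.measurable_Φ, hcomp, Measure.map_snd_prod, measure_univ, one_smul]

/-! ## §2 The fibre transport IS a renormalization transform -/

/-- [folklore] An integrable density pulled back along the parametrisation is integrable for `μ_Z ⊗ dV`. -/
theorem integrable_comp_Φ (A : FibredAveraging P j G avg) {ρ : Density P j G} (hρ : Integrable ρ (fieldMeasure P j G)) :
    Integrable (fun p => ρ (A.Φ p)) (A.μZ.prod (fieldMeasure P (j + 1) G)) := by
  have hρ' : Integrable ρ ((A.μZ.prod (fieldMeasure P (j + 1) G)).map A.Φ) := by rwa [A.map_Φ]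
  exact (integrable_map_measure hρ'.aestronglyMeasurable A.measurable_Φ.aemeasurable).1 hρ'

/-- [folklore] The product integrand of the push-forward identity, `ρ(Φ(z,V))·f(V)` with `f` bounded measurable, is integrable. -/
theorem integrable_comp_Φ_mul (A : FibredAveraging P j G avg) {ρ : Density P j G} (hρ : Integrable ρ (fieldMeasure P j G))
    {f : GaugeField P (j + 1) G → ℝ} (hf : Measurable f) {C : ℝ} (hC : ∀ V, |f V| ≤ C) :
    Integrable (fun p : A.Z × GaugeField P (j + 1) G => ρ (A.Φ p) * f p.2) (A.μZ.prod (fieldMeasure P (j + 1) G)) :=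
  (integrable_comp_Φ A hρ).mul_bdd (hf.comp measurable_snd).aestronglyMeasurable
    (Filter.Eventually.of_forall fun p => by simpa [Real.norm_eq_abs] using hC p.2)

/-- [folklore] **THE FIBRE TRANSPORT OF AN INTEGRABLE DENSITY IS INTEGRABLE** (Fubini). -/
theorem integrable_fibreTransport (A : FibredAveraging P j G avg) {ρ : Density P j G} (hρ : Integrable ρ (fieldMeasure P j G)) :
    Integrable (fibreTransport A ρ) (fieldMeasure P (j + 1) G) :=
  (integrable_comp_Φ A hρ).integral_prod_right

/-- [folklore] **THE FIBRE TRANSPORT IS A RENORMALIZATION TRANSFORM** (typer's `FibreIsRT_stmt`, with `Measurable avg` added): for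
an integrable density `ρ`, `∫ dV (Tρ)(V) f(V) = ∫ dU ρ(U) f(avg U)` for every bounded measurable `f` — Fubini on `μ_Z ⊗ dV`, the
fibre equation `avg ∘ Φ = snd`, and the change of variables `Φ_*(μ_Z ⊗ dV) = dU`. -/
theorem isRT_fibreTransport (A : FibredAveraging P j G avg) (havg : Measurable avg) {ρ : Density P j G}
    (hρ : Integrable ρ (fieldMeasure P j G)) : IsRT avg ρ (fibreTransport A ρ) := by
  intro f hf hfC
  obtain ⟨C, hC⟩ := hfC
  -- left: Fubini
  have hF := integrable_comp_Φ_mul A hρ hf hC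
  have lhs : ∫ V, fibreTransport A ρ V * f V ∂fieldMeasure P (j + 1) G =
      ∫ p, ρ (A.Φ p) * f p.2 ∂A.μZ.prod (fieldMeasure P (j + 1) G) := by
    rw [integral_prod_symm _ hF]
    refine integral_congr_ae (Filter.Eventually.of_forall fun V => ?_)
    show fibreTransport A ρ V * f V = ∫ z, ρ (A.Φ (z, V)) * f V ∂A.μZ
    rw [fibreTransport_apply, integral_mul_const]
  -- right: change of variables along `Φ`
  have rhs : ∫ U, ρ U * f (avg U) ∂fieldMeasure P j G =
      ∫ p, ρ (A.Φ p) * f p.2 ∂A.μZ.prod (fieldMeasure P (j + 1) G) := by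
    have hsm : AEStronglyMeasurable (fun U => ρ U * f (avg U)) ((A.μZ.prod (fieldMeasure P (j + 1) G)).map A.Φ) := by
      rw [A.map_Φ]
      exact hρ.aestronglyMeasurable.mul (hf.comp havg).aestronglyMeasurable
    rw [← A.map_Φ, integral_map A.measurable_Φ.aemeasurable hsm]
    refine integral_congr_ae (Filter.Eventually.of_forall fun p => ?_)
    obtain ⟨z, V⟩ := p
    show ρ (A.Φ (z, V)) * f (avg (A.Φ (z, V))) = ρ (A.Φ (z, V)) * f V
    rw [A.avg_Φ]
  rw [lhs, rhs]

/-! ## §3 Agreement with the transport of record, a.e. -/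

/-- [folklore] **UNIQUENESS OF THE RENORMALIZATION TRANSFORM UP TO NULL SETS**: two INTEGRABLE densities satisfying the push-forward
identity `IsRT avg ρ ·` for the same `ρ` agree `dV`-a.e. (indicator test functions). -/
theorem isRT_unique {ρ : Density P j G} {ρ₁ ρ₂ : Density P (j + 1) G} (h₁ : IsRT avg ρ ρ₁) (h₂ : IsRT avg ρ ρ₂)
    (hi₁ : Integrable ρ₁ (fieldMeasure P (j + 1) G)) (hi₂ : Integrable ρ₂ (fieldMeasure P (j + 1) G)) :
    ρ₁ =ᵐ[fieldMeasure P (j + 1) G] ρ₂ := by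
  refine Integrable.ae_eq_of_forall_setIntegral_eq ρ₁ ρ₂ hi₁ hi₂ fun S hS _ => ?_
  have hind : Measurable (S.indicator fun _ => (1 : ℝ)) := measurable_const.indicator hS
  have hbd : ∃ C : ℝ, ∀ V, |S.indicator (fun _ => (1 : ℝ)) V| ≤ C :=
    ⟨1, fun V => by by_cases hV : V ∈ S <;> simp [hV]⟩
  have e₁ := h₁ _ hind hbd
  have e₂ := h₂ _ hind hbd
  have key : ∫ V, ρ₁ V * S.indicator (fun _ => (1 : ℝ)) V ∂fieldMeasure P (j + 1) G =
      ∫ V, ρ₂ V * S.indicator (fun _ => (1 : ℝ)) V ∂fieldMeasure P (j + 1) G := by rw [e₁, e₂]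
  have hmul : ∀ (g : Density P (j + 1) G) (V : GaugeField P (j + 1) G),
      g V * S.indicator (fun _ => (1 : ℝ)) V = S.indicator g V := fun g V => by
    by_cases hV : V ∈ S <;> simp [hV]
  simp_rw [hmul, integral_indicator hS] at key
  exact key

/-- [folklore] The transport of record `rnTransport avg ρ` of an integrable density is integrable (`dV`). -/
theorem integrable_rnTransport (havg : Measurable avg) (hmap : (fieldMeasure P j G).map avg = fieldMeasure P (j + 1) G)
    {ρ : Density P j G} (hρ : Integrable ρ (fieldMeasure P j G)) :
    Integrable (rnTransport avg ρ) (fieldMeasure P (j + 1) G) := by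
  have h1 : ∀ φ : Density P j G, Integrable φ (fieldMeasure P j G) → Integrable (rnDensity avg φ) (fieldMeasure P (j + 1) G) :=
    fun φ hφ => by
      simpa using (integral_rnDensity_mul avg havg hmap φ hφ (fun _ => (1 : ℝ)) measurable_const 1
        (fun _ => by simp)).1
  by_cases h0 : ∀ U, 0 ≤ ρ U
  · have : rnTransport avg ρ = rnDensity avg ρ := funext fun V => by simp [rnTransport, h0]
    rw [this]
    exact h1 ρ hρ
  · have : rnTransport avg ρ = fun V => rnDensity avg ρ V - rnDensity avg (fun U => -ρ U) V :=
      funext fun V => by simp [rnTransport, h0]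
    rw [this]
    exact (h1 ρ hρ).sub (h1 _ hρ.neg)

/-- [folklore] **THE FIBRE TRANSPORT IS THE TRANSPORT OF RECORD, a.e.** (typer's `FibreTransportAE_stmt`): for measurable `avg` and
integrable `ρ`, `fibreTransport A ρ = AveragingRT.rnTransport avg ρ` `dV`-almost everywhere — both solve the push-forward identity
(`isRT_fibreTransport`, `AveragingRT.isRT_rnTransport` with the Haar compatibility `map_avg_fieldMeasure`), and solutions are unique. -/
theorem fibreTransport_ae_eq_rnTransport (A : FibredAveraging P j G avg) (havg : Measurable avg) {ρ : Density P j G}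
    (hρ : Integrable ρ (fieldMeasure P j G)) :
    fibreTransport A ρ =ᵐ[fieldMeasure P (j + 1) G] rnTransport avg ρ :=
  isRT_unique (isRT_fibreTransport A havg hρ) (isRT_rnTransport avg havg (map_avg_fieldMeasure A havg) ρ hρ)
    (integrable_fibreTransport A hρ) (integrable_rnTransport havg (map_avg_fieldMeasure A havg) hρ)

/-! ## §4 The dressed step: the `wOp` shape of NE1′ F-2 -/

/-- [folklore] The fibre weight is integrable when the real fibre integrand is. -/
theorem integrable_fibreWeight (A : FibredAveraging P j G avg) {ρ : Density P j G} {V : GaugeField P (j + 1) G}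
    (h : Integrable (fun z => ρ (A.Φ (z, V))) A.μZ) : Integrable (fibreWeight A ρ V) A.μZ :=
  h.ofReal

/-- [folklore] The integral of the fibre weight is the fibre transport, as a complex number. -/
theorem integral_fibreWeight (A : FibredAveraging P j G avg) (ρ : Density P j G) (V : GaugeField P (j + 1) G) :
    ∫ z, fibreWeight A ρ V z ∂A.μZ = ((fibreTransport A ρ V : ℝ) : ℂ) := by
  simp only [fibreWeight_apply, fibreTransport_apply]
  exact integral_ofReal

/-- [folklore] **THE DRESSED STEP** (typer's `DressedStep_stmt` = [dict] line D-5): wherever the fibre integrals exist and the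
transported density does not vanish, the fibre transport of the dressed density `ρ·f` is the transported density times the NORMALISED
fibre average of `f` — `∫ ρ(Φ(z,V))·f(Φ(z,V)) dμ_Z = (Tρ)(V) · wOp (fibreWeight A ρ) μ_Z z₀ V (f ∘ Φ(·, V))`, the `T4TrajectoryDensity.wOp`
shape of NE1′ F-2's `hFn` on the (a.e.) transport of record. -/
theorem fibreTransport_dressed (A : FibredAveraging P j G avg) (z₀ : A.Z) (ρ : Density P j G) (f : GaugeField P j G → ℂ)
    (V : GaugeField P (j + 1) G) (hint : Integrable (fun z => ρ (A.Φ (z, V))) A.μZ)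
    (hne : fibreTransport A ρ V ≠ 0) :
    ∫ z, ((ρ (A.Φ (z, V)) : ℝ) : ℂ) * f (A.Φ (z, V)) ∂A.μZ =
      ((fibreTransport A ρ V : ℝ) : ℂ) * wOp (fibreWeight A ρ) A.μZ z₀ V (fun z => f (A.Φ (z, V))) := by
  have hw : Integrable (fibreWeight A ρ V) A.μZ := integrable_fibreWeight A hint
  have hne' : (∫ z, fibreWeight A ρ V z ∂A.μZ) ≠ 0 := by
    rw [integral_fibreWeight]
    exact_mod_cast hne
  rw [wOp_of_pos hw hne', integral_fibreWeight, smul_eq_mul, ← mul_assoc, mul_inv_cancel₀ (by exact_mod_cast hne), one_mul]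
  rfl

/-- [folklore] The same with the second fibre integral displayed as a hypothesis-free rewriting of the left side: the dressed
fibre integral is `∫ fibreWeight · (f ∘ Φ)`. -/
theorem integral_fibreWeight_mul (A : FibredAveraging P j G avg) (ρ : Density P j G) (f : GaugeField P j G → ℂ)
    (V : GaugeField P (j + 1) G) :
    ∫ z, fibreWeight A ρ V z * f (A.Φ (z, V)) ∂A.μZ = ∫ z, ((ρ (A.Φ (z, V)) : ℝ) : ℂ) * f (A.Φ (z, V)) ∂A.μZ := rfl

end Summit.QuantumFields.BalabanUV.T4Continuum.SubstrateFibredAveraging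

end
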